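import Summits.FinalStateConjecture.FinalStateConjecture.Theorems.EIHFluxBalanceInertialRecessionStubIdentificationMainPrep

/-!
# Route EIHFluxBalance — `InertialRecession`, line `sublinear-is-free-clean-window-charges`:
# the window estimate at a fixed time (stub `stub_identification`, part A5c-3)

Helper file (`--supports stmt-FinalStateConjecture-10166`) for the crux
`Summit.FinalStateConjecture.FinalStateConjecture.Theses.EIHFluxBalance.InertialRecession`.

`window_estimate`: at a fixed late time `t`, for a field `g` that is `C^∞`, symmetric and Ricci-flat on
an open set `W` containing the slice points of the perforated window ball, within `1/2` of `η` there with
`‖Dg‖ ≤ K d^{-7/4}`, whose deviation from the modulated background obeys the weighted bounds, and for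
radii `ρ₀` of the small spheres beyond the thresholds (`4ρ₀ ≤ D`, `ρ₀² ≤ D/16`, decay thresholds of every
hole): `|P^μ[g](t; c, R) − Σ_{j ∈ A} P^μ[G_j](t; ξ_j(t), ρ₀)| ≤` bulk (`LLGauss.perforatedGauss`,
`abs_setIntegral_le_of_decay`, `abs_emComplex_le_of_pseudotensorBound`) `+ N ·` small-sphere error
(`abs_quasiLocalMomentum_lab_sub_frozen_le` with the rotation-blind defect `opNorm_defect_le_of_rates`).
[cite: LandauLifshitz1975, §96 (96.16)–(96.17)]
-/

set_option linter.dupNamespace false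
-- instance search on the nested operator spaces needs a deeper pending depth (as in `CoordCurvature.lean`)
set_option maxSynthPendingDepth 3

noncomputable section

open scoped Manifold ContDiff Topology BigOperators ENNReal
open Filter Set Function TopologicalSpace MeasureTheory Metric Literature.Geometry.Lorentzian
open Literature.Geometry.Lorentzian.LandauLifshitz

namespace Summit.FinalStateConjecture.FinalStateConjecture.Theorems

namespace SublinearIsFree.ChargeModel

open SublinearIsFree.PseudotensorBound SublinearIsFree.QuasiStationarity LLBalance

-- the algebraic and the operator-norm instance paths on `E4 →L[ℝ] E4 →L[ℝ] ℝ` unify slowly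
set_option synthInstance.maxHeartbeats 400000 in
set_option maxHeartbeats 6400000 in
/-- **The window estimate at a fixed late time** (see the module docstring): universal constants, then
for every configuration, field `g` regular on an open set `W` containing the slice points of the
perforated window ball, and scalars `ρ₀, Dm, εf` beyond the thresholds, the charge of `g` through the
window sphere is within the explicit error of the sum of the frozen charges of the holes inside.
[cite: LandauLifshitz1975, §96 (96.16)–(96.17)] -/
theorem window_estimate : ∀ {N : ℕ}, 0 < N → ∀ (M a : Fin N → ℝ),
    ∃ (Cs Bv Bw Bd₀ Bd₁ : ℝ) (Cf Rf : Fin N → ℝ), 0 ≤ Cs ∧ 0 ≤ Bv ∧ 0 ≤ Bw ∧ 0 ≤ Bd₀ ∧ 0 ≤ Bd₁ ∧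
      (∀ i, 0 ≤ Cf i ∧ 0 < Rf i) ∧
      ∀ (Λ : Fin N → ℝ → lorentzGroup) (ξ : Fin N → ℝ → E3) (γ Cp K : ℝ) (g : E4 → E4 →L[ℝ] E4 →L[ℝ] ℝ)
        (W : Set E4) (t : ℝ) (c : E3) (R δ : ℝ) (A : Finset (Fin N)) (ρ₀ Dm εf : ℝ),
      (∀ i, ContDiff ℝ 1 (fun s ↦ ((Λ i s : E4 ≃L[ℝ] E4) : E4 →L[ℝ] E4))) → (∀ i, ContDiff ℝ 1 (ξ i)) →
      (∀ i, |((Λ i t : E4 ≃L[ℝ] E4) (E4.basisVector 0)) 0| ≤ γ) → 0 ≤ Cp →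
      (∀ (g : E4 → E4 →L[ℝ] E4 →L[ℝ] ℝ) (x : E4) (b : ℝ), ContDiffAt ℝ 2 g x →
        (∀ᶠ y in 𝓝 x, ∀ v w : E4, g y v w = g y w v) → ‖g x - Minkowski.bilin‖ ≤ 1 / 2 →
        (∀ v : E4, ‖fderiv ℝ g x v‖ ≤ b * ‖v‖) →
        ∀ μ ν : Fin 4, |metricDet g x * pseudotensor g x μ ν| ≤ Cp * b ^ 2) →
      0 ≤ K → IsOpen W → ContDiffOn ℝ ∞ g W → (∀ x ∈ W, ∀ v w : E4, g x v w = g x w v) →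
      (∀ x ∈ W, MetricCoord.ricAt g x = 0) → 0 < δ →
      (∀ j, ‖ξ j t - c‖ ≤ (1 - δ) * R ∨ (1 + δ) * R ≤ ‖ξ j t - c‖) → (∀ j, j ∈ A ↔ ‖ξ j t - c‖ ≤ (1 - δ) * R) →
      4 ≤ ρ₀ → 2 * ρ₀ ≤ δ * R → (∀ i, Rf i + |a i| ≤ ρ₀ ∧ max 1 (2 * |a i|) ≤ ρ₀ ∧ |a i| < ρ₀) →
      2 * (1 + 3 * γ) ^ 2 * (∑ i, |M i|) * Bw ≤ ρ₀ → 4 * ρ₀ ≤ Dm → ρ₀ ^ 2 ≤ Dm / 16 →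
      (∀ i j, i ≠ j → Dm ≤ ‖ξ i t - ξ j t‖) → 0 ≤ εf →
      (∀ y : E3, dist y c ≤ R → (∀ i, ρ₀ ≤ ‖y - ξ i t‖) → E4.ofTimeSpace t y ∈ W ∧
        ‖g (E4.ofTimeSpace t y) - Minkowski.bilin‖ ≤ 1 / 2 ∧
        ∀ v : E4, ‖fderiv ℝ g (E4.ofTimeSpace t y) v‖ ≤ K * ((⨅ i, ‖y - ξ i t‖) ^ (7 / 4 : ℝ))⁻¹ * ‖v‖) →
      (∀ y : E3, dist y c ≤ R → (∀ i, ρ₀ ≤ ‖y - ξ i t‖) → ∀ m : ℕ, m ≤ 3 →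
        (1 + √(√((⨅ i, ‖y - ξ i t‖) ^ 7))) * ‖iteratedFDeriv ℝ m (fun x : E4 ↦ g x - (Minkowski.bilin +
          ∑ i, (boostedKerrBilin (Λ i (x 0)) (E4.ofTimeSpace (x 0) (ξ i (x 0))) (M i) (a i) x - Minkowski.bilin)))
          (E4.ofTimeSpace t y)‖ ≤ εf) →
      ∀ μ : Fin 4, |quasiLocalMomentum g t c R μ -
        ∑ j ∈ A, quasiLocalMomentum (boostedKerrBilin (Λ j t) (E4.ofTimeSpace t (ξ j t)) (M j) (a j)) t (ξ j t) ρ₀ μ| ≤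
        Cp * K ^ 2 * N * (8 * Real.pi * ρ₀ ^ (-(1 / 2) : ℝ)) +
        N * (Cs * (4 * (1 + 3 * γ) ^ 3 * (∑ i, Cf i) * N * Dm⁻¹ +
          N * ((∑ i, |M i|) * (1 + 3 * γ) ^ 2 * ((Bd₁ * (1 + 3 * γ) + 2 * Bd₀) * (4 * (1 + 3 * γ)) *
            ((∑ i, (‖deriv (fun s ↦ (Λ i s : E4 ≃L[ℝ] E4) (E4.basisVector 0)) t‖ +
              if a i = 0 then 0 else ‖deriv (fun s ↦ (Λ i s : E4 ≃L[ℝ] E4) (E4.basisVector 3)) t‖)) * ρ₀) +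
            Bd₁ * (1 + 3 * γ) * (∑ i, ‖deriv (ξ i) t - (((Λ i t : E4 ≃L[ℝ] E4) (E4.basisVector 0)) 0)⁻¹ •
              E4.spatial ((Λ i t : E4 ≃L[ℝ] E4) (E4.basisVector 0))‖))) +
          εf * ρ₀ ^ (1 / 4 : ℝ) +
          (2 * (1 + 3 * γ) ^ 2 * (∑ i, |M i|) * Bv * Dm⁻¹ + εf) * ((1 + 3 * γ) ^ 3 * (∑ i, Cf i)))) := by
  intro N hN M a
  classical
  obtain ⟨Cs, Bv, Cf, Rf, hCs, hBv, hCRf, hSC⟩ := abs_quasiLocalMomentum_lab_sub_frozen_le M a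
  obtain ⟨Bd₀, Bd₁, hBd₀, hBd₁, hDEF⟩ := opNorm_defect_le_of_rates
  obtain ⟨Bw, hBw, hVAL⟩ := norm_frozen_sub_minkowski_le
  refine ⟨Cs, Bv, Bw, Bd₀, Bd₁, Cf, Rf, hCs, hBv, hBw, hBd₀, hBd₁, hCRf, ?_⟩
  intro Λ ξ γ Cp K g W t c R δ A ρ₀ Dm εf hΛ1 hξ1 hγ hCp0 hPTB hK0 hWo hgW hsymm hric hδ0 hclean hA hρ₀4 hρδ hRthr_i
    hBwρ hDmρ hρ₀sqD hDm_le hεf0 hpt hdevb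
  haveI : Nonempty (Fin N) := ⟨⟨0, hN⟩⟩
  -- names
  obtain ⟨G, hG⟩ : ∃ G : ℝ, G = 1 + 3 * γ := ⟨_, rfl⟩
  obtain ⟨Cfm, hCfm⟩ : ∃ Cfm : ℝ, Cfm = ∑ i, Cf i := ⟨_, rfl⟩
  obtain ⟨Mm, hMm⟩ : ∃ Mm : ℝ, Mm = ∑ i, |M i| := ⟨_, rfl⟩
  obtain ⟨rt, hrt⟩ : ∃ rt : ℝ, rt = ∑ i, (‖deriv (fun s ↦ (Λ i s : E4 ≃L[ℝ] E4) (E4.basisVector 0)) t‖ +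
      if a i = 0 then 0 else ‖deriv (fun s ↦ (Λ i s : E4 ≃L[ℝ] E4) (E4.basisVector 3)) t‖) := ⟨_, rfl⟩
  obtain ⟨dt, hdt⟩ : ∃ dt : ℝ, dt = ∑ i, ‖deriv (ξ i) t - (((Λ i t : E4 ≃L[ℝ] E4) (E4.basisVector 0)) 0)⁻¹ •
      E4.spatial ((Λ i t : E4 ≃L[ℝ] E4) (E4.basisVector 0))‖ := ⟨_, rfl⟩
  obtain ⟨dev, hdev⟩ : ∃ dev : E4 → E4 →L[ℝ] E4 →L[ℝ] ℝ, dev = fun x : E4 ↦ g x - (Minkowski.bilin +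
      ∑ i, (boostedKerrBilin (Λ i (x 0)) (E4.ofTimeSpace (x 0) (ξ i (x 0))) (M i) (a i) x - Minkowski.bilin)) := ⟨_, rfl⟩
  have hlabform : (fun x : E4 ↦ (Minkowski.bilin + ∑ i, (boostedKerrBilin (Λ i (x 0)) (E4.ofTimeSpace (x 0) (ξ i (x 0)))
      (M i) (a i) x - Minkowski.bilin)) + dev x) = g := by
    funext x; rw [hdev]; simp only [add_sub_cancel]
  rw [← hG, ← hCfm, ← hMm, ← hrt, ← hdt]
  have hγ1 : 1 ≤ γ := (one_le_abs_lorentz_apply_zero (Λ ⟨0, hN⟩ t)).trans (hγ ⟨0, hN⟩)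
  have hG0 : 0 ≤ G := by rw [hG]; linarith
  have hCfm0 : 0 ≤ Cfm := by rw [hCfm]; exact Finset.sum_nonneg fun i _ ↦ (hCRf i).1
  have hMm0 : 0 ≤ Mm := by rw [hMm]; exact Finset.sum_nonneg fun i _ ↦ abs_nonneg _
  have hCf_le : ∀ i, Cf i ≤ Cfm := fun i ↦ by
    rw [hCfm]; exact Finset.single_le_sum (fun j _ ↦ (hCRf j).1) (Finset.mem_univ i)
  have hM_le : ∀ i, |M i| ≤ Mm := fun i ↦ by
    rw [hMm]; exact Finset.single_le_sum (fun j _ ↦ abs_nonneg (M j)) (Finset.mem_univ i)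
  have hrt0 : 0 ≤ rt := by rw [hrt]; exact Finset.sum_nonneg fun i _ ↦ by split_ifs <;> positivity
  have hdt0 : 0 ≤ dt := by rw [hdt]; exact Finset.sum_nonneg fun i _ ↦ norm_nonneg _
  rw [← hG, ← hMm] at hBwρ
  -- (9) geometry of the window
  have hρ₀0 : 0 < ρ₀ := by linarith
  have hρ₀1 : 1 ≤ ρ₀ := by linarith
  have hR0 : 0 < R := by
    by_contra h
    have : δ * R ≤ 0 := mul_nonpos_of_nonneg_of_nonpos hδ0.le (not_lt.1 h)
    linarith
  have hDm0 : 0 < Dm := by linarith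
  have hout : ∀ j, j ∉ A → (1 + δ) * R ≤ ‖ξ j t - c‖ := fun j hj ↦
    (hclean j).resolve_left fun h ↦ hj ((hA j).2 h)
  have hin : ∀ j, j ∈ A → ‖ξ j t - c‖ ≤ (1 - δ) * R := fun j hj ↦ (hA j).1 hj
  have hfar : ∀ y : E3, dist y c ≤ R → (∀ j, j ∈ A → ρ₀ ≤ ‖y - ξ j t‖) → ∀ i, ρ₀ ≤ ‖y - ξ i t‖ := by
    intro y hy hA' i
    by_cases hi : i ∈ A
    · exact hA' i hi
    · have h1 := hout i hi
      rw [dist_eq_norm] at hy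
      have h2 : ‖ξ i t - c‖ ≤ ‖y - ξ i t‖ + ‖y - c‖ := by
        have := norm_sub_le (y - c) (y - ξ i t)
        rw [sub_sub_sub_cancel_left, norm_sub_rev (ξ i t) c] at this
        linarith [norm_sub_rev c (ξ i t), norm_sub_rev (ξ i t) c]
      nlinarith
  -- (10) the region where the field is regular with nondegenerate Gram matrix
  set W' : Set E4 := W ∩ (fun x ↦ metricDet g x) ⁻¹' ({0}ᶜ : Set ℝ) with hW'def
  have hW'o : IsOpen W' :=
    (contDiffOn_metricDet hgW).continuousOn.isOpen_inter_preimage hWo isOpen_compl_singleton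
  have hlab' : ContDiffOn ℝ ∞ g W' := hgW.mono inter_subset_left
  have hdet' : ∀ x ∈ W', metricDet g x ≠ 0 := fun x hx ↦ hx.2
  have hmemW' : ∀ y : E3, dist y c ≤ R → (∀ i, ρ₀ ≤ ‖y - ξ i t‖) → E4.ofTimeSpace t y ∈ W' := fun y hy hf ↦
    ⟨(hpt y hy hf).1, metricDet_ne_zero (hpt y hy hf).2.1⟩
  -- (11) the holes inside the window and the perforated Gauss law
  set n : ℕ := A.card with hn
  set e : Fin n ≃ {j // j ∈ A} := A.equivFin.symm with he
  have hnN : (n : ℝ) ≤ N := by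
    have h : A.card ≤ N := (Finset.card_le_univ A).trans_eq (Fintype.card_fin N)
    exact_mod_cast h
  have hN1 : (1 : ℝ) ≤ N := by exact_mod_cast hN
  have hfarK : ∀ y : E3, dist y c ≤ R → (∀ k : Fin n, ρ₀ ≤ dist y (ξ (e k) t)) → ∀ i, ρ₀ ≤ ‖y - ξ i t‖ :=
    fun y hy hk ↦ hfar y hy fun j hj ↦ by
      have h := hk (e.symm ⟨j, hj⟩)
      rwa [Equiv.apply_symm_apply, dist_eq_norm] at h
  have hPG : ∀ μ : Fin 4, quasiLocalMomentum g t c R μ - ∑ k : Fin n, quasiLocalMomentum g t (ξ (e k) t) ρ₀ μ =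
      ∫ y in {y : E3 | dist y c ≤ R ∧ ∀ k : Fin n, ρ₀ ≤ dist y (ξ (e k) t)},
        emComplex g (E4.ofTimeSpace t y) μ 0 := fun μ ↦ by
    refine LLGauss.perforatedGauss hW'o hlab' hdet' (ξ := fun k ↦ ξ (e k) t) (ρ := fun _ ↦ ρ₀) hR0
      (fun _ ↦ hρ₀0) (fun k ↦ ?_) (fun k k' hkk' ↦ ?_) (fun y hy hk ↦ hmemW' y hy (hfarK y hy hk)) μ
    · have h1 := hin _ (e k).2
      rw [dist_eq_norm]
      nlinarith
    · have hne : ((e k : {j // j ∈ A}) : Fin N) ≠ ((e k' : {j // j ∈ A}) : Fin N) := fun h ↦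
        hkk' (e.injective (Subtype.ext h))
      have h1 := hDm_le _ _ hne
      rw [dist_eq_norm]
      linarith
  -- (12) the bulk bound
  have hbulk : ∀ μ : Fin 4, |∫ y in {y : E3 | dist y c ≤ R ∧ ∀ k : Fin n, ρ₀ ≤ dist y (ξ (e k) t)},
      emComplex g (E4.ofTimeSpace t y) μ 0| ≤ Cp * K ^ 2 * N * (8 * Real.pi * ρ₀ ^ (-(1 / 2) : ℝ)) := by
    intro μ
    refine abs_setIntegral_le_of_decay (fun i ↦ ξ i t) hρ₀0 (L := Cp * K ^ 2) (by positivity)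
      (LLGauss.isCompact_perforated c R _ _).isClosed.measurableSet (fun y hy i ↦ hfarK y hy.1 hy.2 i)
      (fun y hy ↦ ?_)
    have hfy := hfarK y hy.1 hy.2
    obtain ⟨-, hyη, hyb⟩ := hpt y hy.1 hfy
    have hxW' := hmemW' y hy.1 hfy
    have hg2 : ContDiffAt ℝ 2 g (E4.ofTimeSpace t y) :=
      (hlab'.contDiffAt (hW'o.mem_nhds hxW')).of_le (by norm_cast)
    have hsym : ∀ᶠ z in 𝓝 (E4.ofTimeSpace t y), ∀ v w : E4, g z v w = g z w v :=
      Filter.eventually_of_mem (hWo.mem_nhds hxW'.1) fun z hz ↦ hsymm z hz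
    have hric' : MetricCoord.ricAt g (E4.ofTimeSpace t y) = 0 := hric _ hxW'.1
    have h := abs_emComplex_le_of_pseudotensorBound hPTB hg2 hsym hyη hyb hric' μ 0
    refine h.trans ?_
    have hd0 : 0 < ⨅ i, ‖y - ξ i t‖ := hρ₀0.trans_le (le_ciInf hfy)
    rw [mul_pow, inv_rpow_seven_fourths_sq hd0, mul_assoc]
    exact mul_le_mul_of_nonneg_left (mul_le_mul_of_nonneg_left (rpow_iInf_norm_sub_le_sum hN _ y) (sq_nonneg K)) hCp0
  -- (13) the small spheres
  obtain ⟨Δt, hΔt⟩ : ∃ Δt : ℝ, Δt = Mm * G ^ 2 * ((Bd₁ * G + 2 * Bd₀) * (4 * G) * (rt * ρ₀) / ρ₀ ^ 2 +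
      Bd₁ * G * dt / ρ₀ ^ 2) := ⟨_, rfl⟩
  have hΔt0 : 0 ≤ Δt := by
    rw [hΔt]
    have := hrt0; have := hdt0
    positivity
  have hsph : ∀ j, j ∈ A → ∀ y ∈ sphere (ξ j t) ρ₀, ‖y - ξ j t‖ = ρ₀ ∧ dist y c ≤ R ∧
      (∀ i, i ≠ j → Dm / 2 ≤ ‖y - ξ i t‖) ∧ (∀ i, ρ₀ ≤ ‖y - ξ i t‖) ∧ (⨅ i, ‖y - ξ i t‖) = ρ₀ := by
    intro j hj y hy
    have hyj : ‖y - ξ j t‖ = ρ₀ := by rwa [mem_sphere, dist_eq_norm] at hy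
    have hyc : dist y c ≤ R := by
      have h1 := dist_triangle y (ξ j t) c
      rw [dist_eq_norm, dist_eq_norm, dist_eq_norm] at *
      have h2 := hin j hj
      nlinarith
    have hyi : ∀ i, i ≠ j → Dm / 2 ≤ ‖y - ξ i t‖ := fun i hij ↦ by
      have h1 := hDm_le j i (Ne.symm hij)
      have h2 : ‖ξ j t - ξ i t‖ ≤ ‖y - ξ i t‖ + ‖y - ξ j t‖ := by
        have := norm_sub_le (y - ξ i t) (y - ξ j t)
        rw [sub_sub_sub_cancel_left] at this
        linarith [norm_sub_rev (ξ j t) (ξ i t)]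
      linarith
    have hall : ∀ i, ρ₀ ≤ ‖y - ξ i t‖ := fun i ↦ by
      by_cases hij : i = j
      · rw [hij, hyj]
      · linarith [hyi i hij]
    exact ⟨hyj, hyc, hyi, hall, le_antisymm ((ciInf_le (Set.finite_range _).bddBelow j).trans hyj.le)
      (le_ciInf hall)⟩
  have hsphere : ∀ j, j ∈ A → ∀ μ : Fin 4,
      |quasiLocalMomentum g t (ξ j t) ρ₀ μ -
        quasiLocalMomentum (boostedKerrBilin (Λ j t) (E4.ofTimeSpace t (ξ j t)) (M j) (a j)) t (ξ j t) ρ₀ μ| ≤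
      Cs * (4 * G ^ 3 * Cfm * N * Dm⁻¹ +
        N * (Mm * G ^ 2 * ((Bd₁ * G + 2 * Bd₀) * (4 * G) * (rt * ρ₀) + Bd₁ * G * dt)) +
        εf * ρ₀ ^ (1 / 4 : ℝ) + (2 * G ^ 2 * Mm * Bv * Dm⁻¹ + εf) * (G ^ 3 * Cfm)) := by
    intro j hj μ
    have haj : |a j| < ρ₀ := (hRthr_i j).2.2
    -- the hypotheses of the small-sphere comparison
    have hdevS : ∀ y ∈ sphere (ξ j t) ρ₀, DifferentiableAt ℝ dev (E4.ofTimeSpace t y) ∧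
        ‖dev (E4.ofTimeSpace t y)‖ ≤ εf ∧ ‖fderiv ℝ dev (E4.ofTimeSpace t y)‖ ≤ εf * (ρ₀ ^ (7 / 4 : ℝ))⁻¹ := by
      intro y hy
      obtain ⟨hyj, hyc, hyi, hall, hinf⟩ := hsph j hj y hy
      have hxW' := hmemW' y hyc hall
      have hw : ∀ m : ℕ, m ≤ 3 → (1 + ρ₀ ^ (7 / 4 : ℝ)) * ‖iteratedFDeriv ℝ m dev (E4.ofTimeSpace t y)‖ ≤ εf := by
        intro m hm
        have h := hdevb y hyc hall m hm
        rwa [hinf, WindowBounds.sqrt_sqrt_pow_seven hρ₀0.le, ← hdev] at h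
      have hw1 : 1 ≤ 1 + ρ₀ ^ (7 / 4 : ℝ) := le_add_of_nonneg_right (Real.rpow_nonneg hρ₀0.le _)
      have hp0 : 0 < ρ₀ ^ (7 / 4 : ℝ) := Real.rpow_pos_of_pos hρ₀0 _
      have hGbd : DifferentiableAt ℝ (fun x : E4 ↦ Minkowski.bilin + ∑ i, (boostedKerrBilin (Λ i (x 0))
          (E4.ofTimeSpace (x 0) (ξ i (x 0))) (M i) (a i) x - Minkowski.bilin)) (E4.ofTimeSpace t y) := by
        have hs : DifferentiableAt ℝ (fun x ↦ ∑ i, (boostedKerrBilin (Λ i (x 0)) (E4.ofTimeSpace (x 0) (ξ i (x 0)))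
            (M i) (a i) x - Minkowski.bilin)) (E4.ofTimeSpace t y) :=
          DifferentiableAt.fun_sum fun i _ ↦ (contDiffAt_summand (M := M i) (a := a i) (hΛ1 i) (hξ1 i)
            (E4.ofTimeSpace_apply_zero t y) (by
              rw [E4.spatial_ofTimeSpace]; exact (hRthr_i i).2.1.trans (hall i))).differentiableAt
              one_ne_zero
        exact hs.const_add Minkowski.bilin
      have hgd : DifferentiableAt ℝ g (E4.ofTimeSpace t y) :=
        (hlab'.contDiffAt (hW'o.mem_nhds hxW')).differentiableAt (by norm_cast)
      have hdevd : DifferentiableAt ℝ dev (E4.ofTimeSpace t y) := by rw [hdev]; exact hgd.sub hGbd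
      refine ⟨hdevd, ?_, ?_⟩
      · have h := hw 0 (by norm_num)
        rw [norm_iteratedFDeriv_zero] at h
        have : ‖dev (E4.ofTimeSpace t y)‖ ≤ (1 + ρ₀ ^ (7 / 4 : ℝ)) * ‖dev (E4.ofTimeSpace t y)‖ :=
          le_mul_of_one_le_left (norm_nonneg _) hw1
        linarith
      · have h := hw 1 (by norm_num)
        rw [norm_iteratedFDeriv_one] at h
        rw [le_mul_inv_iff₀ hp0]
        calc ‖fderiv ℝ dev (E4.ofTimeSpace t y)‖ * ρ₀ ^ (7 / 4 : ℝ)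
            ≤ (1 + ρ₀ ^ (7 / 4 : ℝ)) * ‖fderiv ℝ dev (E4.ofTimeSpace t y)‖ := by
              nlinarith [norm_nonneg (fderiv ℝ dev (E4.ofTimeSpace t y))]
          _ ≤ εf := h
    have hdefS : ∀ i, ∀ y ∈ sphere (ξ j t) ρ₀,
        ‖fderiv ℝ (fun x : E4 ↦ boostedKerrBilin (Λ i (x 0)) (E4.ofTimeSpace (x 0) (ξ i (x 0))) (M i) (a i) x)
            (E4.ofTimeSpace t y) -
          fderiv ℝ (boostedKerrBilin (Λ i t) (E4.ofTimeSpace t (ξ i t)) (M i) (a i)) (E4.ofTimeSpace t y)‖ ≤ Δt := by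
      intro i y hy
      obtain ⟨-, -, -, hall, -⟩ := hsph j hj y hy
      have hd : max 1 (2 * |a i|) ≤ ‖E4.spatial (E4.ofTimeSpace t y) - ξ i t‖ := by
        rw [E4.spatial_ofTimeSpace]; exact (hRthr_i i).2.1.trans (hall i)
      have h := hDEF (M i) (a i) γ (Λ i) (ξ i) t (E4.ofTimeSpace t y) (hΛ1 i) (hξ1 i) (hγ i)
        (E4.ofTimeSpace_apply_zero t y) hd
      rw [← hG] at h
      refine h.trans ?_
      rw [hΔt, E4.spatial_ofTimeSpace]
      refine defectBound_mono (hM_le i) hG0 hBd₀ hBd₁ (by positivity) ?_ (norm_nonneg _) ?_ hρ₀0 (hall i)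
      · rw [hrt]
        exact Finset.single_le_sum (f := fun i ↦ ‖deriv (fun s ↦ (Λ i s : E4 ≃L[ℝ] E4) (E4.basisVector 0)) t‖ +
          if a i = 0 then 0 else ‖deriv (fun s ↦ (Λ i s : E4 ≃L[ℝ] E4) (E4.basisVector 3)) t‖)
          (fun i _ ↦ by split_ifs <;> positivity) (Finset.mem_univ i)
      · rw [hdt]
        exact Finset.single_le_sum (f := fun i ↦ ‖deriv (ξ i) t - (((Λ i t : E4 ≃L[ℝ] E4) (E4.basisVector 0)) 0)⁻¹ •
          E4.spatial ((Λ i t : E4 ≃L[ℝ] E4) (E4.basisVector 0))‖) (fun i _ ↦ norm_nonneg _) (Finset.mem_univ i)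
    have hηS : ∀ y ∈ sphere (ξ j t) ρ₀,
        ‖g (E4.ofTimeSpace t y) - Minkowski.bilin‖ ≤ 1 / 2 ∧
        ‖boostedKerrBilin (Λ j t) (E4.ofTimeSpace t (ξ j t)) (M j) (a j) (E4.ofTimeSpace t y) - Minkowski.bilin‖ ≤ 1 / 2 := by
      intro y hy
      obtain ⟨hyj, hyc, -, hall, -⟩ := hsph j hj y hy
      refine ⟨(hpt y hyc hall).2.1, ?_⟩
      have hd : max 1 (2 * |a j|) ≤ ‖E4.spatial (E4.ofTimeSpace t y) - ξ j t‖ := by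
        rw [E4.spatial_ofTimeSpace]; exact (hRthr_i j).2.1.trans (hall j)
      have h := hVAL (Λ j t) (ξ j t) (M j) (a j) t (E4.ofTimeSpace t y) (E4.ofTimeSpace_apply_zero t y) hd
      rw [E4.spatial_ofTimeSpace, hyj] at h
      refine h.trans ?_
      have hA2 : ‖(((Λ j t : E4 ≃L[ℝ] E4).symm : E4 →L[ℝ] E4))‖ ^ 2 ≤ G ^ 2 :=
        pow_le_pow_left₀ (norm_nonneg _) ((norm_lorentz_symm_le' (Λ j t)).trans (by rw [hG]; linarith [hγ j])) 2
      have h2 : |M j| * Bw / ρ₀ ≤ Mm * Bw / ρ₀ :=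
        div_le_div_of_nonneg_right (mul_le_mul_of_nonneg_right (hM_le j) hBw) hρ₀0.le
      have h3 : G ^ 2 * (Mm * Bw / ρ₀) ≤ 1 / 2 := by
        rw [mul_div_assoc', div_le_iff₀ hρ₀0]
        linarith [hBwρ]
      calc ‖(((Λ j t : E4 ≃L[ℝ] E4).symm : E4 →L[ℝ] E4))‖ ^ 2 * (|M j| * Bw / ρ₀)
          ≤ G ^ 2 * (Mm * Bw / ρ₀) := mul_le_mul hA2 h2 (by positivity) (sq_nonneg _)
        _ ≤ 1 / 2 := h3
    have hcontL : ∀ k : Fin 3, ContinuousOn (fun y ↦ hField g (E4.ofTimeSpace t y) μ 0 k.succ) (sphere (ξ j t) ρ₀) :=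
      fun k ↦ (contDiffOn_hField hW'o hlab' hdet' μ 0 k.succ).continuousOn.comp
        (E4.continuous_ofTimeSpace t).continuousOn fun y hy ↦
          hmemW' y (hsph j hj y hy).2.1 (hsph j hj y hy).2.2.2.1
    have hcontG : ∀ k : Fin 3, ContinuousOn (fun y ↦ hField (boostedKerrBilin (Λ j t) (E4.ofTimeSpace t (ξ j t)) (M j) (a j))
        (E4.ofTimeSpace t y) μ 0 k.succ) (sphere (ξ j t) ρ₀) :=
      fun k ↦ continuousOn_hField_frozen_sphere (Λ j t) (ξ j t) (M j) (a j) t haj μ k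
    rw [← hlabform] at hηS hcontL
    have hSCj := hSC Λ ξ γ dev t j ρ₀ (Dm / 2) εf (εf * (ρ₀ ^ (7 / 4 : ℝ))⁻¹) (fun _ ↦ Δt) μ hΛ1 hξ1
      hγ hρ₀0 (fun i ↦ (hRthr_i i).1) (fun i ↦ (hRthr_i i).2.1) (by linarith)
      hεf0 (mul_nonneg hεf0 (inv_nonneg.2 (Real.rpow_nonneg hρ₀0.le _))) (fun _ ↦ hΔt0)
      (fun i hij y hy ↦ (hsph j hj y hy).2.2.1 i hij) hdevS hdefS hηS hcontL hcontG
    rw [hlabform, ← hG] at hSCj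
    refine hSCj.trans ?_
    -- bookkeeping of the four terms
    have hE1 : (∑ i, (G ^ 3 * Cf i / (Dm / 2) ^ 2 + Δt)) = 4 * G ^ 3 * Cfm / Dm ^ 2 + N * Δt := by
      rw [Finset.sum_add_distrib, Finset.sum_const, Finset.card_univ, Fintype.card_fin, nsmul_eq_mul, hCfm,
        Finset.mul_sum, Finset.sum_div]
      congr 1
      refine Finset.sum_congr rfl fun i _ ↦ ?_
      field_simp
      ring
    have hE2 : (∑ i, G ^ 2 * (|M i| * Bv / (Dm / 2))) = 2 * G ^ 2 * Mm * Bv / Dm := by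
      have h : ∀ i, G ^ 2 * (|M i| * Bv / (Dm / 2)) = (2 * G ^ 2 * Bv / Dm) * |M i| := fun i ↦ by
        field_simp
      rw [Finset.sum_congr rfl (fun i _ ↦ h i), ← Finset.mul_sum, ← hMm]
      field_simp
    have hE3 : ρ₀ ^ 2 * (εf * (ρ₀ ^ (7 / 4 : ℝ))⁻¹) = εf * ρ₀ ^ (1 / 4 : ℝ) := by
      have h : ρ₀ ^ 2 = ρ₀ ^ (7 / 4 : ℝ) * ρ₀ ^ (1 / 4 : ℝ) := by
        rw [← Real.rpow_add hρ₀0, ← Real.rpow_natCast _ 2]; norm_num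
      rw [h]
      field_simp
    have hT1' : ρ₀ ^ 2 * (4 * G ^ 3 * Cfm / Dm ^ 2) ≤ 4 * G ^ 3 * Cfm * N * Dm⁻¹ := by
      have h1 : ρ₀ ^ 2 * (4 * G ^ 3 * Cfm / Dm ^ 2) ≤ Dm / 16 * (4 * G ^ 3 * Cfm / Dm ^ 2) :=
        mul_le_mul_of_nonneg_right hρ₀sqD (by positivity)
      refine h1.trans ?_
      rw [show Dm / 16 * (4 * G ^ 3 * Cfm / Dm ^ 2) = G ^ 3 * Cfm / 4 * Dm⁻¹ by field_simp; ring,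
        show 4 * G ^ 3 * Cfm * N * Dm⁻¹ = (4 * G ^ 3 * Cfm * N) * Dm⁻¹ by ring]
      refine mul_le_mul_of_nonneg_right ?_ (inv_nonneg.2 hDm0.le)
      nlinarith [mul_nonneg (pow_nonneg hG0 3) hCfm0]
    have hT2' : ρ₀ ^ 2 * (N * Δt) = N * (Mm * G ^ 2 * ((Bd₁ * G + 2 * Bd₀) * (4 * G) * (rt * ρ₀) +
        Bd₁ * G * dt)) := by
      rw [hΔt]
      field_simp
    have hT4' : ρ₀ ^ 2 * ((2 * G ^ 2 * Mm * Bv / Dm + εf) * (G ^ 3 * Cf j / ρ₀ ^ 2)) ≤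
        (2 * G ^ 2 * Mm * Bv * Dm⁻¹ + εf) * (G ^ 3 * Cfm) := by
      rw [show ρ₀ ^ 2 * ((2 * G ^ 2 * Mm * Bv / Dm + εf) * (G ^ 3 * Cf j / ρ₀ ^ 2)) =
        (2 * G ^ 2 * Mm * Bv * Dm⁻¹ + εf) * (G ^ 3 * Cf j) by field_simp]
      refine mul_le_mul_of_nonneg_left (mul_le_mul_of_nonneg_left (hCf_le j) (pow_nonneg hG0 3)) ?_
      have := hεf0
      positivity
    rw [hE1, hE2]
    have hsum : Cs * ρ₀ ^ 2 * (4 * G ^ 3 * Cfm / Dm ^ 2 + ↑N * Δt + εf * (ρ₀ ^ (7 / 4 : ℝ))⁻¹ +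
        (2 * G ^ 2 * Mm * Bv / Dm + εf) * (G ^ 3 * Cf j / ρ₀ ^ 2)) =
        Cs * (ρ₀ ^ 2 * (4 * G ^ 3 * Cfm / Dm ^ 2) + ρ₀ ^ 2 * (N * Δt) +
          ρ₀ ^ 2 * (εf * (ρ₀ ^ (7 / 4 : ℝ))⁻¹) +
          ρ₀ ^ 2 * ((2 * G ^ 2 * Mm * Bv / Dm + εf) * (G ^ 3 * Cf j / ρ₀ ^ 2))) := by ring
    rw [hsum, hE3, hT2']
    refine mul_le_mul_of_nonneg_left ?_ hCs
    linarith
  -- (15) conclusion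
  have hsumA : ∀ f : Fin N → ℝ, ∑ k : Fin n, f (e k) = ∑ j ∈ A, f j := fun f ↦ by
    rw [Equiv.sum_comp e (fun j : {j // j ∈ A} ↦ f j), Finset.sum_coe_sort]
  intro μ
  have h1 := hPG μ
  have h2 := hbulk μ
  rw [← hsumA]
  have h3 : |∑ k : Fin n, (quasiLocalMomentum g t (ξ (e k) t) ρ₀ μ -
      quasiLocalMomentum (boostedKerrBilin (Λ (e k) t) (E4.ofTimeSpace t (ξ (e k) t)) (M (e k)) (a (e k))) t
        (ξ (e k) t) ρ₀ μ)| ≤ N * (Cs * (4 * G ^ 3 * Cfm * N * Dm⁻¹ +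
      N * (Mm * G ^ 2 * ((Bd₁ * G + 2 * Bd₀) * (4 * G) * (rt * ρ₀) + Bd₁ * G * dt)) +
      εf * ρ₀ ^ (1 / 4 : ℝ) + (2 * G ^ 2 * Mm * Bv * Dm⁻¹ + εf) * (G ^ 3 * Cfm))) := by
    refine (Finset.abs_sum_le_sum_abs _ _).trans ?_
    refine (Finset.sum_le_sum fun k _ ↦ hsphere _ (e k).2 μ).trans ?_
    rw [Finset.sum_const, Finset.card_univ, Fintype.card_fin, nsmul_eq_mul]
    refine mul_le_mul_of_nonneg_right hnN ?_
    have := hrt0; have := hdt0; have := hεf0; have := inv_nonneg.2 hDm0.le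
    positivity
  have hsplit : quasiLocalMomentum g t c R μ - ∑ k : Fin n,
      quasiLocalMomentum (boostedKerrBilin (Λ (e k) t) (E4.ofTimeSpace t (ξ (e k) t)) (M (e k)) (a (e k))) t
        (ξ (e k) t) ρ₀ μ =
      (quasiLocalMomentum g t c R μ - ∑ k : Fin n, quasiLocalMomentum g t (ξ (e k) t) ρ₀ μ) +
      ∑ k : Fin n, (quasiLocalMomentum g t (ξ (e k) t) ρ₀ μ -
        quasiLocalMomentum (boostedKerrBilin (Λ (e k) t) (E4.ofTimeSpace t (ξ (e k) t)) (M (e k)) (a (e k))) t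
          (ξ (e k) t) ρ₀ μ) := by
    rw [Finset.sum_sub_distrib]; ring
  rw [hsplit, h1]
  exact (abs_add_le _ _).trans (add_le_add h2 h3)

end SublinearIsFree.ChargeModel

end Summit.FinalStateConjecture.FinalStateConjecture.Theorems

end
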